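import Mathlib
import Summits.HubbardSuperconductivity.HubbardSuperconductivity.Theorems.BalabanIRBirGappedPhaseReductionRBlockLondonStripColumn
import Summits.HubbardSuperconductivity.HubbardSuperconductivity.Theorems.BalabanIRBirGappedPhaseReductionRBlockLondonStripCount
import Summits.HubbardSuperconductivity.HubbardSuperconductivity.Theorems.BalabanIRBirGappedPhaseReductionRBlockLondonPositivity

/-!
# Route BalabanIR — crux 4R `BirGappedPhaseReductionR` (item `stmt-HubbardSuperconductivity-14846`):
# block-London coercivity IXa — the Fermi-strip stiffness bound (hypothesis (K1)): the strip sum near one Fermi point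

This file: `stiffness_case` (the strip sum near one Fermi point: columns `strip_column`, points
`strip_pointwise`, counting `StripCount`) and the constant bookkeeping `stiffness_finish`; the
assembly over the two diagonal Fermi points is in `…StripStiffness`.
THEOREM (`kernelSymbol_stiffness`, next file).  For `μ ∈ (-4,4)` and a cone parameter `ε > 0` there are
`q₀, c₁, Δ₀ > 0` such that for all gaps `Δ₁, Δ₂ ≠ 0` with `|Δ₁| ≤ |Δ₂|/ε` and `|Δ₁| + |Δ₂| ≤ Δ₀`
and all `L ≥ L₀(Δ)`, the structure factor of the anomalous-amplitude symbol `f = Δ/E` of the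
`d+id` BdG reference obeys the gap-uniform STIFFNESS bound
  `c₁ ‖v‖²_∞ ≤ |Δ₂| · N⁻¹ Σ_k |f_k - f_{k+q}|²`
for every texture momentum `q` and every representative `v ≡ 2πq/L (mod 2π)` with
`‖v‖_∞ ≤ q₀ |Δ₂|`.  PROOF: restrict the `k`-sum to the Fermi strips near the two diagonal Fermi
points `(p*, p*)`, `(p*, 2π - p*)` (`cos p* = -μ/4`), whose normals span the plane
(`stiffness_case`: columns `strip_column`, points `strip_pointwise`, counting `StripCount`).
Together with (K2) (`kernelSymbol_pos_far`) this gives the kernel symbol inequality on the cone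
`ε|Δ₂| ≤ |Δ₁| ≤ |Δ₂|/ε` and hence, through `bdgBlockLondonCoercivity_of_kernelSymbolIneq`, the
block-London rigidity with a gap-independent constant.  No definition is introduced.
-/

noncomputable section

namespace Summit.HubbardSuperconductivity.HubbardSuperconductivity.Theorems

namespace BirBdG

open Finset Literature.Probability.LatticeModels

/-- Either `u₀ + u₁` or `u₀ - u₁` dominates both `|u₀|` and `|u₁|`. [folklore] -/
theorem abs_le_abs_add_or_sub (u₀ u₁ : ℝ) :
    (|u₀| ≤ |u₀ + u₁| ∧ |u₁| ≤ |u₀ + u₁|) ∨ (|u₀| ≤ |u₀ - u₁| ∧ |u₁| ≤ |u₀ - u₁|) := by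
  rcases le_total |u₀ - u₁| |u₀ + u₁| with h | h
  · left
    constructor
    · have := abs_add_le (u₀ + u₁) (u₀ - u₁)
      rw [show u₀ + u₁ + (u₀ - u₁) = 2 * u₀ by ring, abs_mul, abs_two] at this
      linarith
    · have := abs_sub (u₀ + u₁) (u₀ - u₁)
      rw [show u₀ + u₁ - (u₀ - u₁) = 2 * u₁ by ring, abs_mul, abs_two] at this
      linarith
  · right
    constructor
    · have := abs_add_le (u₀ + u₁) (u₀ - u₁)
      rw [show u₀ + u₁ + (u₀ - u₁) = 2 * u₀ by ring, abs_mul, abs_two] at this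
      linarith
    · have := abs_sub (u₀ + u₁) (u₀ - u₁)
      rw [show u₀ + u₁ - (u₀ - u₁) = 2 * u₁ by ring, abs_mul, abs_two] at this
      linarith

/-- **The strip sum near one Fermi point** (the common core of the two cases of
`kernelSymbol_stiffness`): columns `|p₁ - b₁| ≤ ρS/8` (`≥ ρSL/64` of them), rows from
`strip_column` (`≥ DL/16` per column), points from `strip_pointwise`. [folklore] -/
theorem stiffness_case (L : ℕ) [NeZero L] (μ Δ₁ Δ₂ S D ρ : ℝ) (σ b v : Fin 2 → ℝ)
    (fc : (Fin 2 → ℝ) → ℂ)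
    (hfc : ∀ p, fc p = (((2 * Δ₁ * (Real.cos (p 0) - Real.cos (p 1)) : ℝ) : ℂ) -
        4 * Complex.I * ((Δ₂ * Real.sin (p 0) * Real.sin (p 1) : ℝ) : ℂ)) /
      ((Real.sqrt ((-2 * Real.cos (p 0) - 2 * Real.cos (p 1) - μ) ^ 2 +
        ‖((2 * Δ₁ * (Real.cos (p 0) - Real.cos (p 1)) : ℝ) : ℂ) -
          4 * Complex.I * ((Δ₂ * Real.sin (p 0) * Real.sin (p 1) : ℝ) : ℂ)‖ ^ 2) : ℝ) : ℂ))
    (hσ : ∀ i, σ i = 1 ∨ σ i = -1) (hS : ∀ i, σ i * Real.sin (b i) = S) (hsin0 : Real.sin (b 0) = S)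
    (hSpos : 0 < S) (hρ : 0 < ρ) (h16ρ : 16 * ρ ≤ S)
    (hb0 : -2 * Real.cos (b 0) - 2 * Real.cos (b 1) - μ = 0)
    (hD : ‖(((2 * Δ₁ * (Real.cos (b 0) - Real.cos (b 1)) : ℝ) : ℂ) -
        4 * Complex.I * ((Δ₂ * Real.sin (b 0) * Real.sin (b 1) : ℝ) : ℂ))‖ = D) (hDpos : 0 < D)
    (hρD : (2 * |Δ₁| + 4 * |Δ₂|) * (4 * ρ) ≤ D / 10) (hsmall : 2 * |Δ₁| + 4 * |Δ₂| ≤ S / 22)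
    (hDρ : 18 / 10 * D ≤ ρ * S / 4)
    (hrange0 : ρ ≤ b 0 ∧ b 0 + ρ < 2 * Real.pi)
    (hrange1 : ρ * S / 8 ≤ b 1 ∧ b 1 + ρ * S / 8 < 2 * Real.pi)
    (hvρ : ∀ i, |v i| ≤ ρ) (hvD : ∀ i, |v i| ≤ D / 40)
    (hw : ∀ i, |2 * Real.sin (v i / 2)| ≤ |σ 0 * (2 * Real.sin (v 0 / 2)) + σ 1 * (2 * Real.sin (v 1 / 2))|)
    (hL1 : 64 / D ≤ L) (hL2 : 64 / (ρ * S) ≤ L) :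
    (ρ * S * L / 64) * (D * L / 16) *
        (S * |σ 0 * (2 * Real.sin (v 0 / 2)) + σ 1 * (2 * Real.sin (v 1 / 2))| / (572 * D)) ^ 2 ≤
      ∑ k : TorusSite 2 L, ‖fc (latticeMomentum L k) - fc (latticeMomentum L k + v)‖ ^ 2 := by
  classical
  have hπ := Real.pi_pos
  have hLpos : (0 : ℝ) < L := by exact_mod_cast Nat.pos_of_ne_zero (NeZero.ne L)
  -- the continuum symbols (crux-3 stencils)
  set ξc : (Fin 2 → ℝ) → ℝ := fun p => -2 * Real.cos (p 0) - 2 * Real.cos (p 1) - μ with hξc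
  set Δc : (Fin 2 → ℝ) → ℂ := fun p => (((2 * Δ₁ * (Real.cos (p 0) - Real.cos (p 1)) : ℝ) : ℂ) -
      4 * Complex.I * ((Δ₂ * Real.sin (p 0) * Real.sin (p 1) : ℝ) : ℂ)) with hΔc
  have hfc' : ∀ p, fc p = Δc p / ((Real.sqrt (ξc p ^ 2 + ‖Δc p‖ ^ 2) : ℝ) : ℂ) := fun p => hfc p
  have hbξ : ξc b = 0 := hb0
  have hbD : ‖Δc b‖ = D := hD
  set w : ℝ := σ 0 * (2 * Real.sin (v 0 / 2)) + σ 1 * (2 * Real.sin (v 1 / 2)) with hw_def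
  set cpt : ℝ := (S * |w| / (572 * D)) ^ 2 with hcpt
  -- columns
  set ρ' : ℝ := ρ * S / 8 with hρ'
  have hρ'pos : 0 < ρ' := by positivity
  set J₁ : Finset ℕ := (Finset.range L).filter (fun j : ℕ =>
    b 1 - ρ' ≤ 2 * Real.pi * j / L ∧ 2 * Real.pi * j / L ≤ b 1 + ρ') with hJ₁
  have hJ₁L : ∀ j ∈ J₁, j < L := fun j hj => Finset.mem_range.1 (Finset.mem_filter.1 hj).1
  have hJ₁card : ρ * S * L / 64 ≤ (J₁.card : ℝ) := by
    have h := card_latticePoints_Icc_ge L (α := b 1 - ρ') (β := b 1 + ρ') (by linarith [hrange1.1])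
      hrange1.2
    have e : (b 1 + ρ' - (b 1 - ρ')) * L / (2 * Real.pi) = ρ' * L / Real.pi := by
      field_simp; ring
    rw [e] at h
    -- `ρ' L/π - 1 ≥ ρ' L/4 - 1 ≥ ρ' L / 8 = ρ S L / 64`
    have h4 : ρ' * L / 4 ≤ ρ' * L / Real.pi := by
      gcongr; linarith [Real.pi_lt_four]
    have h8 : 1 ≤ ρ' * L / 8 := by
      rw [hρ', le_div_iff₀ (by norm_num : (0:ℝ) < 8)]
      have := hL2
      rw [div_le_iff₀ (by positivity)] at this
      linarith
    have : ρ * S * L / 64 = ρ' * L / 8 := by rw [hρ']; ring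
    rw [this]
    linarith
  -- rows: the good points of a column, by property
  set good : ℕ → ℕ → Prop := fun j₁ j₀ =>
    (∀ i, |(![2 * Real.pi * j₀ / L, 2 * Real.pi * j₁ / L] : Fin 2 → ℝ) i - b i| ≤ ρ) ∧
      (1 / 2 ≤ ξc ![2 * Real.pi * j₀ / L, 2 * Real.pi * j₁ / L] /
          ‖Δc ![2 * Real.pi * j₀ / L, 2 * Real.pi * j₁ / L]‖ ∧
        ξc ![2 * Real.pi * j₀ / L, 2 * Real.pi * j₁ / L] /
          ‖Δc ![2 * Real.pi * j₀ / L, 2 * Real.pi * j₁ / L]‖ ≤ 2) with hgood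
  set J₀ : ℕ → Finset ℕ := fun j₁ => (Finset.range L).filter (fun j₀ => good j₁ j₀) with hJ₀
  have hJ₀L : ∀ j₁ ∈ J₁, ∀ j₀ ∈ J₀ j₁, j₀ < L := fun j₁ _ j₀ hj₀ =>
    Finset.mem_range.1 (Finset.mem_filter.1 hj₀).1
  have hJ₀card : ∀ j₁ ∈ J₁, D * L / 16 ≤ ((J₀ j₁).card : ℝ) := by
    intro j₁ hj₁
    have hp₁ : |2 * Real.pi * j₁ / L - b 1| ≤ ρ * S / 8 := by
      have := (Finset.mem_filter.1 hj₁).2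
      exact abs_le.2 ⟨by linarith [this.1], by linarith [this.2]⟩
    obtain ⟨α, β, hα, hαβ, hβ, hlen, hgoodx⟩ := strip_column μ Δ₁ Δ₂ S D ρ (2 * Real.pi * j₁ / L) b
      ξc (fun _ => rfl) Δc (fun _ => rfl) hSpos hρ h16ρ hbξ hsin0 hbD hDpos hρD hDρ hp₁
    have hsub : (Finset.range L).filter (fun j : ℕ =>
        α ≤ 2 * Real.pi * j / L ∧ 2 * Real.pi * j / L ≤ β) ⊆ J₀ j₁ := by
      intro j hj
      rw [Finset.mem_filter] at hj ⊢
      exact ⟨hj.1, hgoodx _ hj.2.1 hj.2.2⟩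
    have h := card_latticePoints_Icc_ge L (α := α) (β := β) (by linarith [hrange0.1]) (by linarith [hrange0.2])
    have hc := Finset.card_le_card hsub
    have hc' : (((Finset.range L).filter (fun j : ℕ =>
        α ≤ 2 * Real.pi * j / L ∧ 2 * Real.pi * j / L ≤ β)).card : ℝ) ≤ ((J₀ j₁).card : ℝ) := by
      exact_mod_cast hc
    -- `(β-α)L/(2π) - 1 ≥ (5D/8) L/8 - 1 ≥ D L/16` using `D L ≥ 64`
    have h1 : 5 / 8 * D * L / 8 ≤ (β - α) * L / (2 * Real.pi) := by
      rw [div_le_div_iff₀ (by norm_num) (by positivity)]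
      have h8 : 2 * Real.pi ≤ 8 := by linarith [Real.pi_lt_four]
      have hβα : 5 / 8 * D ≤ β - α := hlen
      have hA : 5 / 8 * D * L * (2 * Real.pi) ≤ 5 / 8 * D * L * 8 :=
        mul_le_mul_of_nonneg_left h8 (by positivity)
      have hB : 5 / 8 * D * L * 8 ≤ (β - α) * L * 8 :=
        mul_le_mul_of_nonneg_right (mul_le_mul_of_nonneg_right hβα hLpos.le) (by norm_num)
      linarith
    have h2 : 1 ≤ D * L / 64 := by
      rw [le_div_iff₀ (by norm_num : (0:ℝ) < 64)]
      have := hL1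
      rw [div_le_iff₀ hDpos] at this
      linarith
    linarith
  -- the pointwise bound on the family
  have hc : ∀ j₁ ∈ J₁, ∀ j₀ ∈ J₀ j₁, cpt ≤
      (fun k : TorusSite 2 L => ‖fc (latticeMomentum L k) - fc (latticeMomentum L k + v)‖ ^ 2)
        ![((j₀ : ℕ) : ZMod L), ((j₁ : ℕ) : ZMod L)] := by
    intro j₁ hj₁ j₀ hj₀
    have hgj := (Finset.mem_filter.1 hj₀).2
    have hj₀L := hJ₀L j₁ hj₁ j₀ hj₀
    have hj₁L := hJ₁L j₁ hj₁
    simp only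
    rw [latticeMomentum_natCast hj₀L hj₁L]
    have hpt := strip_pointwise μ Δ₁ Δ₂ S D ρ σ b
      (![2 * Real.pi * j₀ / L, 2 * Real.pi * j₁ / L]) v ξc Δc fc (fun _ => rfl) (fun _ => rfl) hfc'
      hσ hS hSpos hρ h16ρ hbD hDpos hρD hsmall hgj.1 hgj.2 hvρ hvD hw
    rw [hcpt]
    exact pow_le_pow_left₀ (by positivity) hpt 2
  -- sum over the family
  have hsum := sum_torus_ge_of_columns
    (fun k : TorusSite 2 L => ‖fc (latticeMomentum L k) - fc (latticeMomentum L k + v)‖ ^ 2)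
    (fun k => by positivity) J₁ hJ₁L J₀ hJ₀L cpt hc
  refine le_trans ?_ hsum
  have hcpt0 : 0 ≤ cpt := by positivity
  calc ρ * S * L / 64 * (D * L / 16) * (S * |w| / (572 * D)) ^ 2
      = ρ * S * L / 64 * (D * L / 16 * cpt) := by rw [hcpt]; ring
    _ ≤ (J₁.card : ℝ) * (D * L / 16 * cpt) :=
        mul_le_mul_of_nonneg_right hJ₁card (by positivity)
    _ = ∑ _j₁ ∈ J₁, D * L / 16 * cpt := by rw [Finset.sum_const, nsmul_eq_mul]
    _ ≤ ∑ j₁ ∈ J₁, ((J₀ j₁).card : ℝ) * cpt :=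
        Finset.sum_le_sum fun j₁ hj₁ => mul_le_mul_of_nonneg_right (hJ₀card j₁ hj₁) hcpt0

/-- The constant bookkeeping of `kernelSymbol_stiffness`: with `D = 4 a S²`,
`a · (ρSL/64)(DL/16)(S w/(572 D))² = ρ S L² w² / 1340145664`. [folklore] -/
theorem stiffness_const_identity : ∀ (ρ S L D a w : ℝ), D = 4 * a * S ^ 2 → 0 < a → 0 < S → a * ((ρ * S * L / 64) * (D * L / 16) * (S * w / (572 * D)) ^ 2) = ρ * S * L ^ 2 * w ^ 2 / 1340145664 := by
  intro ρ S L D a w hD ha hS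
  have hD0 : D ≠ 0 := by rw [hD]; positivity
  rw [hD] at hD0 ⊢
  field_simp
  ring

/-- The final arithmetic of `kernelSymbol_stiffness`: a strip bound with `η ≤ 2|w|` gives
`c₁ η² ≤ a · L⁻² · Tot` for `c₁ = ρS/(6·10⁹)`. [folklore] -/
theorem stiffness_finish (ρ S D a L c₁ η w Tot : ℝ) (hD : D = 4 * a * S ^ 2) (ha : 0 < a)
    (hS : 0 < S) (hρ : 0 < ρ) (hL : 0 < L) (hc₁ : c₁ = ρ * S / (6 * 10 ^ 9)) (hη0 : 0 ≤ η)
    (hηw : η ≤ 2 * |w|)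
    (hcase : (ρ * S * L / 64) * (D * L / 16) * (S * |w| / (572 * D)) ^ 2 ≤ Tot) :
    c₁ * η ^ 2 ≤ a * ((L ^ 2)⁻¹ * Tot) := by
  have hL2pos : 0 < L ^ 2 := pow_pos hL 2
  have hA := stiffness_const_identity ρ S L D a |w| hD ha hS
  have hlow : ρ * S * L ^ 2 * |w| ^ 2 / 1340145664 ≤ a * Tot := by
    rw [← hA]; exact mul_le_mul_of_nonneg_left hcase ha.le
  have hη2 : η ^ 2 ≤ 4 * |w| ^ 2 := by
    calc η ^ 2 ≤ (2 * |w|) ^ 2 := pow_le_pow_left₀ hη0 hηw 2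
      _ = 4 * |w| ^ 2 := by ring
  have hc₁pos : 0 < c₁ := by rw [hc₁]; positivity
  have hX : 0 ≤ ρ * S * L ^ 2 * |w| ^ 2 := by positivity
  have key : c₁ * η ^ 2 * L ^ 2 ≤ a * Tot := by
    have h1 : c₁ * η ^ 2 * L ^ 2 ≤ c₁ * (4 * |w| ^ 2) * L ^ 2 :=
      mul_le_mul_of_nonneg_right (mul_le_mul_of_nonneg_left hη2 hc₁pos.le) (sq_nonneg _)
    have e1 : c₁ * (4 * |w| ^ 2) * L ^ 2 = (ρ * S * L ^ 2 * |w| ^ 2) * (4 / (6 * 10 ^ 9)) := by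
      rw [hc₁]; ring
    have e2 : ρ * S * L ^ 2 * |w| ^ 2 / 1340145664 =
        (ρ * S * L ^ 2 * |w| ^ 2) * (1 / 1340145664) := by ring
    have h2 : (ρ * S * L ^ 2 * |w| ^ 2) * (4 / (6 * 10 ^ 9)) ≤
        (ρ * S * L ^ 2 * |w| ^ 2) * (1 / 1340145664) :=
      mul_le_mul_of_nonneg_left (by norm_num) hX
    rw [← e1, ← e2] at h2
    exact h1.trans (h2.trans hlow)
  calc c₁ * η ^ 2 = (c₁ * η ^ 2 * L ^ 2) * (L ^ 2)⁻¹ := by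
        rw [mul_assoc (c₁ * η ^ 2), mul_inv_cancel₀ hL2pos.ne', mul_one]
    _ ≤ (a * Tot) * (L ^ 2)⁻¹ := mul_le_mul_of_nonneg_right key (inv_nonneg.2 hL2pos.le)
    _ = a * ((L ^ 2)⁻¹ * Tot) := by ring

/-- `|w| ≥ η/2` for the dominating chord combination (`|vᵢ| ≤ 1`). [folklore] -/
theorem max_abs_le_two_mul_abs {v : Fin 2 → ℝ} {w : ℝ} (hv : ∀ i, |v i| ≤ 1)
    (hw : ∀ i, |2 * Real.sin (v i / 2)| ≤ |w|) : max |v 0| |v 1| ≤ 2 * |w| := by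
  have hvπ : ∀ i, |v i| ≤ Real.pi := fun i => by linarith [hv i, Real.pi_gt_three]
  have key : ∀ i, |v i| ≤ 2 * |w| := by
    intro i
    have h1 := (abs_le_two_sin_half (hvπ i)).trans (hw i)
    have hπ4 := Real.pi_lt_four
    have hπ0 := Real.pi_pos
    rw [div_mul_eq_mul_div, div_le_iff₀ hπ0] at h1
    nlinarith [abs_nonneg (v i), abs_nonneg w]
  exact max_le (key 0) (key 1)

end BirBdG

end Summit.HubbardSuperconductivity.HubbardSuperconductivity.Theorems

end
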